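import Summits.Ventures.PercRepro.PuncturedLYMSuper

/-!
# PercRepro — (SP) BY SUPERPOSITION, PART 2: THE EXACT 2-PATH RE-ROUTING OF THE CLIQUE ERRORS — THE CORRECTION, ITS
ROW SUMS AND ITS LOWER BOUND (p10, gen 31)

The superposition (PuncturedLYMSuper) has row sums `1` and column sums `#P/#Y + errE D B y` at `Y = insert y B`
(`errE` zero-sum over `y ∉ B`).  The error is moved along the 2-paths
`B ∪ y → row (B ∖ b) ∪ y → column (B ∖ b) ∪ {y, y'} → row (B ∖ b) ∪ y' → B ∪ y'` (`errE y > 0 > errE y'`, `b ∈ B`), each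
carrying `errE(y)·|errE(y')|/(j·S_B)`, `S_B = Σ_{y ∉ B} errE⁺`.  Summed, the correction at a completion `X ↦ insert y X`
with `X` NEAR `B` (`#(X ∩ B) + 1 = j`, `X ∖ B = {x}`, `B ∖ X = {b}`) is

    reroute D B X y = (1/j)·( −errE(x)                                             if y = b,
                              (errE(x)⁺·errE(y)⁻ − errE(x)⁻·errE(y)⁺)/S_B           if y ≠ b ),

and `0` when `X` is not near `B`; `totalW = superW + Σ_B reroute D B` are the corrected weights.
* `sum_reroute_row` — the row sums of `reroute D B` vanish;
* `reroute_ge`, `card_near_le`, `sum_reroute_ge` — the correction is at least `−M/j` per near word when `M` bounds every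
  positive error of the word, and at most `j` words are near a given `X`, so `Σ_B reroute D B X y ≥ −M`.
The column sums (`−errE D B y₀` at `insert y₀ B`, `0` elsewhere) and the exact rows / columns of `totalW` are
PuncturedLYMRerouteCols.  Nothing here asserts (SP).
-/

namespace PercRepro.PuncturedLYM

open Finset

variable {α : Type} [Fintype α] [DecidableEq α]

/-! ### The positive error and the correction -/

/-- `S_B = Σ_{y ∉ B} errE⁺`, the total positive error on the clique of `B`. -/
def errPos (α : Type) [Fintype α] [DecidableEq α] (j : ℕ) (D : Finset (Finset α)) (B : Finset α) : ℚ :=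
  ∑ y ∈ univ \ B, max (errE α j D B y) 0

/-- The re-routing correction of the word `B` at the completion `X ↦ insert y X` (see the module docstring). -/
def reroute (α : Type) [Fintype α] [DecidableEq α] (j : ℕ) (D : Finset (Finset α)) (B X : Finset α) (y : α) : ℚ :=
  if (X ∩ B).card + 1 = j then
    (1 / (j : ℚ)) * ∑ x ∈ X \ B, ∑ b ∈ B \ X,
      (if y = b then - errE α j D B x
       else (max (errE α j D B x) 0 * max (- errE α j D B y) 0
             - max (- errE α j D B x) 0 * max (errE α j D B y) 0) / errPos α j D B)
  else 0

/-- The correction on a pair `(X, Y)`: `reroute` at the point of `Y ∖ X`. -/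
def reroutep (α : Type) [Fintype α] [DecidableEq α] (j : ℕ) (D : Finset (Finset α)) (B X Y : Finset α) : ℚ :=
  ∑ y ∈ Y \ X, reroute α j D B X y

/-- The corrected weights: the superposition plus the corrections of all the words. -/
def totalW (α : Type) [Fintype α] [DecidableEq α] (j : ℕ) (D : Finset (Finset α)) (X : Finset α) (y : α) : ℚ :=
  superW α j D X y + ∑ B ∈ D, reroute α j D B X y

/-- The corrected weights on a pair `(X, Y)`. -/
def totalWp (α : Type) [Fintype α] [DecidableEq α] (j : ℕ) (D : Finset (Finset α)) (X Y : Finset α) : ℚ :=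
  ∑ y ∈ Y \ X, totalW α j D X y

/-- `reroutep X (insert y X) = reroute X y` for `y ∉ X`. -/
theorem reroutep_insert (j : ℕ) (D : Finset (Finset α)) (B X : Finset α) {y : α} (hy : y ∉ X) :
    reroutep α j D B X (insert y X) = reroute α j D B X y := by
  unfold reroutep
  have h : insert y X \ X = {y} := by
    ext z
    simp only [mem_sdiff, mem_insert, mem_singleton]
    constructor
    · rintro ⟨h1, h2⟩
      exact h1.resolve_right h2
    · rintro rfl
      exact ⟨Or.inl rfl, hy⟩
  rw [h, sum_singleton]

/-- `totalWp X (insert y X) = totalW X y` for `y ∉ X`. -/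
theorem totalWp_insert (j : ℕ) (D : Finset (Finset α)) (X : Finset α) {y : α} (hy : y ∉ X) :
    totalWp α j D X (insert y X) = totalW α j D X y := by
  unfold totalWp
  have h : insert y X \ X = {y} := by
    ext z
    simp only [mem_sdiff, mem_insert, mem_singleton]
    constructor
    · rintro ⟨h1, h2⟩
      exact h1.resolve_right h2
    · rintro rfl
      exact ⟨Or.inl rfl, hy⟩
  rw [h, sum_singleton]

/-- The correction vanishes when `X` is not near `B`. -/
theorem reroute_of_not_near (j : ℕ) (D : Finset (Finset α)) (B X : Finset α) (y : α)
    (h : (X ∩ B).card + 1 ≠ j) : reroute α j D B X y = 0 := by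
  unfold reroute
  rw [if_neg h]

omit [Fintype α] in
/-- For `j`-sets `X`, `B` with `#(X ∩ B) + 1 = j`, `X ∖ B` and `B ∖ X` are single points. -/
theorem near_sdiff {j : ℕ} {X B : Finset α} (hX : X.card = j) (hB : B.card = j) (hn : (X ∩ B).card + 1 = j) :
    (∃ x, X \ B = {x}) ∧ ∃ b, B \ X = {b} := by
  have h1 := card_sdiff_add_card_inter X B
  have h2 := card_sdiff_add_card_inter B X
  rw [inter_comm] at h2
  exact ⟨card_eq_one.1 (by omega), card_eq_one.1 (by omega)⟩

/-- The correction at a near `X` (`X ∖ B = {x}`, `B ∖ X = {b}`). -/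
theorem reroute_near {j : ℕ} (D : Finset (Finset α)) {B X : Finset α} (hn : (X ∩ B).card + 1 = j) {x b : α}
    (hx : X \ B = {x}) (hb : B \ X = {b}) (y : α) :
    reroute α j D B X y = (1 / (j : ℚ)) *
      (if y = b then - errE α j D B x
       else (max (errE α j D B x) 0 * max (- errE α j D B y) 0
             - max (- errE α j D B x) 0 * max (errE α j D B y) 0) / errPos α j D B) := by
  unfold reroute
  rw [if_pos hn, hx, hb, sum_singleton, sum_singleton]

/-! ### The positive and negative errors -/

/-- `max a 0 − max (−a) 0 = a`. -/
theorem max_sub_max_neg (a : ℚ) : max a 0 - max (-a) 0 = a := by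
  by_cases h : 0 ≤ a
  · rw [max_eq_left h, max_eq_right (by linarith)]
    ring
  · have h' : a < 0 := not_le.1 h
    rw [max_eq_right h'.le, max_eq_left (by linarith)]
    ring

/-- The total negative error equals the total positive error (`errE` is zero-sum). -/
theorem errPos_eq_sum_neg {j : ℕ} {D : Finset (Finset α)} (hD : IsCode j D) (hjn : j < Fintype.card α)
    {B : Finset α} (hB : B ∈ D) : errPos α j D B = ∑ y ∈ univ \ B, max (- errE α j D B y) 0 := by
  have h := sum_errE hD hjn hB
  have h2 : ∑ y ∈ univ \ B, errE α j D B y =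
      ∑ y ∈ univ \ B, (max (errE α j D B y) 0 - max (- errE α j D B y) 0) :=
    sum_congr rfl (fun y _ => (max_sub_max_neg _).symm)
  rw [h2, sum_sub_distrib] at h
  unfold errPos
  linarith

/-- If the total positive error vanishes, every error vanishes. -/
theorem errE_eq_zero_of_errPos {j : ℕ} {D : Finset (Finset α)} (hD : IsCode j D) (hjn : j < Fintype.card α)
    {B : Finset α} (hB : B ∈ D) (hS : errPos α j D B = 0) {y : α} (hy : y ∉ B) : errE α j D B y = 0 := by
  have hpos : max (errE α j D B y) 0 = 0 := by
    have := (sum_eq_zero_iff_of_nonneg (fun z _ => le_max_right (errE α j D B z) 0)).1 hS y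
      (mem_sdiff.2 ⟨mem_univ y, hy⟩)
    exact this
  have hneg : max (- errE α j D B y) 0 = 0 := by
    have hS' := hS
    rw [errPos_eq_sum_neg hD hjn hB] at hS'
    exact (sum_eq_zero_iff_of_nonneg (fun z _ => le_max_right (- errE α j D B z) 0)).1 hS' y
      (mem_sdiff.2 ⟨mem_univ y, hy⟩)
  have := max_sub_max_neg (errE α j D B y)
  rw [hpos, hneg] at this
  linarith

/-- Each positive part is at most the total positive error. -/
theorem max_errE_le_errPos {j : ℕ} (D : Finset (Finset α)) {B : Finset α} {y : α} (hy : y ∉ B) :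
    max (errE α j D B y) 0 ≤ errPos α j D B :=
  single_le_sum (fun z _ => le_max_right (errE α j D B z) 0) (mem_sdiff.2 ⟨mem_univ y, hy⟩)

/-- Each negative part is at most the total positive error. -/
theorem max_neg_errE_le_errPos {j : ℕ} {D : Finset (Finset α)} (hD : IsCode j D) (hjn : j < Fintype.card α)
    {B : Finset α} (hB : B ∈ D) {y : α} (hy : y ∉ B) : max (- errE α j D B y) 0 ≤ errPos α j D B := by
  rw [errPos_eq_sum_neg hD hjn hB]
  exact single_le_sum (fun z _ => le_max_right (- errE α j D B z) 0) (mem_sdiff.2 ⟨mem_univ y, hy⟩)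

/-! ### Row sums of the correction -/

omit [Fintype α] in
/-- For `X` near `B` (`X ∖ B = {x}`, `B ∖ X = {b}`): the points outside `X` other than `b` are the points outside `B`
other than `x`. -/
theorem erase_sdiff_near {X B : Finset α} {x b : α} (hx : X \ B = {x}) (hb : B \ X = {b}) (U : Finset α) :
    (U \ X).erase b = (U \ B).erase x := by
  have hxX : x ∈ X := (mem_sdiff.1 (hx ▸ mem_singleton_self x)).1
  have hxB : x ∉ B := (mem_sdiff.1 (hx ▸ mem_singleton_self x)).2
  have hbB : b ∈ B := (mem_sdiff.1 (hb ▸ mem_singleton_self b)).1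
  have hbX : b ∉ X := (mem_sdiff.1 (hb ▸ mem_singleton_self b)).2
  ext y
  simp only [mem_erase, mem_sdiff]
  constructor
  · rintro ⟨hyb, hyU, hyX⟩
    refine ⟨fun h => hyX (h ▸ hxX), hyU, fun hyB => ?_⟩
    have : y ∈ B \ X := mem_sdiff.2 ⟨hyB, hyX⟩
    rw [hb, mem_singleton] at this
    exact hyb this
  · rintro ⟨hyx, hyU, hyB⟩
    refine ⟨fun h => hyB (h ▸ hbB), hyU, fun hyX => ?_⟩
    have : y ∈ X \ B := mem_sdiff.2 ⟨hyX, hyB⟩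
    rw [hx, mem_singleton] at this
    exact hyx this

/-- **The row sums of the correction vanish** at every `j`-set `X` (`B ∈ D`, `j < n`). -/
theorem sum_reroute_row {j : ℕ} {D : Finset (Finset α)} (hD : IsCode j D) (hjn : j < Fintype.card α)
    {B : Finset α} (hB : B ∈ D) {X : Finset α} (hX : X.card = j) :
    ∑ y ∈ univ \ X, reroute α j D B X y = 0 := by
  by_cases hn : (X ∩ B).card + 1 = j
  · obtain ⟨⟨x, hx⟩, ⟨b, hb⟩⟩ := near_sdiff hX (hD.1 B hB) hn
    have hbX : b ∉ X := (mem_sdiff.1 (hb ▸ mem_singleton_self b)).2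
    have hxB : x ∉ B := (mem_sdiff.1 (hx ▸ mem_singleton_self x)).2
    have hbU : b ∈ univ \ X := mem_sdiff.2 ⟨mem_univ b, hbX⟩
    have hxU : x ∈ univ \ B := mem_sdiff.2 ⟨mem_univ x, hxB⟩
    simp_rw [reroute_near D hn hx hb]
    rw [← mul_sum, ← add_sum_erase _ _ hbU, if_pos rfl, erase_sdiff_near hx hb]
    have hrest : ∀ y ∈ (univ \ B).erase x, (if y = b then - errE α j D B x
        else (max (errE α j D B x) 0 * max (- errE α j D B y) 0
             - max (- errE α j D B x) 0 * max (errE α j D B y) 0) / errPos α j D B) =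
        (max (errE α j D B x) 0 * max (- errE α j D B y) 0
             - max (- errE α j D B x) 0 * max (errE α j D B y) 0) / errPos α j D B := by
      intro y hy
      have hyb : y ≠ b := by
        intro h
        have := (mem_sdiff.1 (mem_of_mem_erase hy)).2
        exact this (h ▸ (mem_sdiff.1 (hb ▸ mem_singleton_self b)).1)
      rw [if_neg hyb]
    rw [sum_congr rfl hrest, ← sum_div, sum_sub_distrib, ← mul_sum, ← mul_sum]
    -- the partial sums over `(univ ∖ B).erase x`
    have hS := errPos_eq_sum_neg hD hjn hB
    have hneg : ∑ y ∈ (univ \ B).erase x, max (- errE α j D B y) 0 = errPos α j D B - max (- errE α j D B x) 0 := by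
      rw [hS, ← sum_erase_add _ _ hxU]
      ring
    have hpos : ∑ y ∈ (univ \ B).erase x, max (errE α j D B y) 0 = errPos α j D B - max (errE α j D B x) 0 := by
      unfold errPos
      rw [← sum_erase_add _ _ hxU]
      ring
    rw [hneg, hpos]
    have hE := max_sub_max_neg (errE α j D B x)
    by_cases hS0 : errPos α j D B = 0
    · have := errE_eq_zero_of_errPos hD hjn hB hS0 hxB
      rw [hS0, this]
      simp
    · have : max (errE α j D B x) 0 * (errPos α j D B - max (- errE α j D B x) 0)
          - max (- errE α j D B x) 0 * (errPos α j D B - max (errE α j D B x) 0) =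
          errPos α j D B * errE α j D B x := by
        linear_combination (errPos α j D B) * hE
      rw [this]
      have h2 : errPos α j D B * errE α j D B x / errPos α j D B = errE α j D B x := by
        field_simp
      rw [h2]
      ring
  · rw [sum_eq_zero]
    intro y _
    exact reroute_of_not_near j D B X y hn

/-! ### Lower bounds for the correction -/

/-- **The correction is at least `−M/j`** when `M` bounds every positive error of `B` (`X` a `j`-set, `y ∉ X`,
`B ∈ D`, `j < n`). -/
theorem reroute_ge {j : ℕ} {D : Finset (Finset α)} (hD : IsCode j D) (hjn : j < Fintype.card α) {B : Finset α}
    (hB : B ∈ D) {M : ℚ} (hM : ∀ y ∉ B, max (errE α j D B y) 0 ≤ M) {X : Finset α} (hX : X.card = j) {y : α}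
    (hy : y ∉ X) : - M / j ≤ reroute α j D B X y := by
  have hM0 : 0 ≤ M := by
    obtain ⟨b, hb⟩ : ∃ b, b ∉ B := by
      by_contra h
      have hall : ∀ w, w ∈ B := fun w => by
        by_contra hw
        exact h ⟨w, hw⟩
      have : (univ : Finset α) ⊆ B := fun w _ => hall w
      have := card_le_card this
      rw [card_univ, hD.1 B hB] at this
      omega
    exact le_trans (le_max_right _ _) (hM b hb)
  have hj0 : (0 : ℚ) ≤ j := by positivity
  by_cases hn : (X ∩ B).card + 1 = j
  · obtain ⟨⟨x, hx⟩, ⟨b, hb⟩⟩ := near_sdiff hX (hD.1 B hB) hn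
    have hxB : x ∉ B := (mem_sdiff.1 (hx ▸ mem_singleton_self x)).2
    rw [reroute_near D hn hx hb y]
    have hjpos : (0 : ℚ) < j := by
      have : 0 < j := by omega
      exact_mod_cast this
    rw [div_eq_mul_one_div, mul_comm]
    apply mul_le_mul_of_nonneg_left _ (by positivity)
    split_ifs with hyb
    · -- `−errE x ≥ −errE⁺ x ≥ −M`
      have := hM x hxB
      have := le_max_left (errE α j D B x) 0
      linarith
    · -- `y ∉ B`: the term is `≥ −errE⁻(x)·errE⁺(y)/S ≥ −errE⁺(y) ≥ −M`
      have hyB : y ∉ B := by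
        intro hyB
        have : y ∈ B \ X := mem_sdiff.2 ⟨hyB, hy⟩
        rw [hb, mem_singleton] at this
        exact hyb this
      have hA : 0 ≤ max (errE α j D B x) 0 * max (- errE α j D B y) 0 :=
        mul_nonneg (le_max_right _ _) (le_max_right _ _)
      have hC := max_neg_errE_le_errPos hD hjn hB hxB
      have hy' := hM y hyB
      have hy0 := le_max_right (errE α j D B y) 0
      by_cases hS : errPos α j D B = 0
      · rw [hS, div_zero]
        linarith
      · have hSpos : 0 < errPos α j D B :=
          lt_of_le_of_ne (sum_nonneg (fun z _ => le_max_right _ _)) (Ne.symm hS)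
        rw [le_div_iff₀ hSpos]
        -- `−M·S ≤ A − C·E⁺(y)` since `C ≤ S` and `E⁺(y) ≤ M`
        have : max (- errE α j D B x) 0 * max (errE α j D B y) 0 ≤ errPos α j D B * M :=
          mul_le_mul hC hy' hy0 hSpos.le
        linarith
  · rw [reroute_of_not_near j D B X y hn, neg_div]
    have : 0 ≤ M / j := div_nonneg hM0 hj0
    linarith

omit [Fintype α] in
/-- At most `j` code words are near a given `j`-set `X` (the map `B ↦ X ∩ B` into the `(j−1)`-subsets of `X` is
injective on a code). -/
theorem card_near_le {j : ℕ} {D : Finset (Finset α)} (hD : IsCode j D) {X : Finset α} (hX : X.card = j) :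
    (D.filter (fun B => (X ∩ B).card + 1 = j)).card ≤ j := by
  rcases Nat.eq_zero_or_pos j with hj0 | hjpos
  · have : D.filter (fun B => (X ∩ B).card + 1 = j) = ∅ := by
      rw [filter_eq_empty_iff]
      intro B _
      omega
    rw [this, card_empty]
    omega
  obtain ⟨j', rfl⟩ : ∃ j', j = j' + 1 := ⟨j - 1, by omega⟩
  have hinj : Set.InjOn (fun B => X ∩ B) (D.filter (fun B => (X ∩ B).card + 1 = j' + 1) : Set (Finset α)) := by
    intro B hB B' hB' h
    rw [mem_coe, mem_filter] at hB hB'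
    have h' : X ∩ B = X ∩ B' := h
    by_contra hne
    have h1 := hD.2 B hB.1 B' hB'.1 hne
    have h2 : X ∩ B ⊆ B ∩ B' := by
      intro w hw
      have hw' : w ∈ X ∩ B' := by
        rw [← h']
        exact hw
      rw [mem_inter] at hw hw' ⊢
      exact ⟨hw.2, hw'.2⟩
    have := card_le_card h2
    omega
  have hsub : (D.filter (fun B => (X ∩ B).card + 1 = j' + 1)).image (fun B => X ∩ B) ⊆ X.powersetCard j' := by
    intro S hS
    rw [mem_image] at hS
    obtain ⟨B, hB, rfl⟩ := hS
    rw [mem_filter] at hB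
    rw [mem_powersetCard]
    exact ⟨inter_subset_left, by omega⟩
  calc (D.filter (fun B => (X ∩ B).card + 1 = j' + 1)).card
      = ((D.filter (fun B => (X ∩ B).card + 1 = j' + 1)).image (fun B => X ∩ B)).card :=
        (card_image_of_injOn hinj).symm
    _ ≤ (X.powersetCard j').card := card_le_card hsub
    _ = j' + 1 := by rw [card_powersetCard, hX, Nat.choose_succ_self_right]

/-- **The total correction at a completion is at least `−M`** when `0 ≤ M` bounds every positive error of every word
(`X` a `j`-set, `y ∉ X`, `j < n`). -/
theorem sum_reroute_ge {j : ℕ} {D : Finset (Finset α)} (hD : IsCode j D) (hjn : j < Fintype.card α) {M : ℚ}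
    (hM0 : 0 ≤ M) (hM : ∀ B ∈ D, ∀ y ∉ B, max (errE α j D B y) 0 ≤ M) {X : Finset α} (hX : X.card = j) {y : α}
    (hy : y ∉ X) : - M ≤ ∑ B ∈ D, reroute α j D B X y := by
  rw [← sum_filter_add_sum_filter_not D (fun B => (X ∩ B).card + 1 = j)]
  have h1 : ∑ B ∈ D.filter (fun B => ¬ (X ∩ B).card + 1 = j), reroute α j D B X y = 0 := by
    apply sum_eq_zero
    intro B hB
    exact reroute_of_not_near j D B X y (mem_filter.1 hB).2
  rw [h1, add_zero]
  rcases Nat.eq_zero_or_pos j with hj0 | hjpos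
  · -- `j = 0`: nothing is near
    have : D.filter (fun B => (X ∩ B).card + 1 = j) = ∅ := by
      rw [filter_eq_empty_iff]
      intro B _
      omega
    rw [this, sum_empty]
    linarith
  · have hjq : (0 : ℚ) < j := by exact_mod_cast hjpos
    have hMj : - M / j ≤ 0 := div_nonpos_of_nonpos_of_nonneg (by linarith) hjq.le
    have h2 : ∑ B ∈ D.filter (fun B => (X ∩ B).card + 1 = j), (- M / j) ≤
        ∑ B ∈ D.filter (fun B => (X ∩ B).card + 1 = j), reroute α j D B X y := by
      apply sum_le_sum
      intro B hB
      exact reroute_ge hD hjn (mem_filter.1 hB).1 (hM B (mem_filter.1 hB).1) hX hy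
    rw [sum_const, nsmul_eq_mul] at h2
    have h4 : ((D.filter (fun B => (X ∩ B).card + 1 = j)).card : ℚ) ≤ j := by
      exact_mod_cast card_near_le hD hX
    have h5 : (j : ℚ) * (- M / j) ≤ ((D.filter (fun B => (X ∩ B).card + 1 = j)).card : ℚ) * (- M / j) :=
      mul_le_mul_of_nonpos_right h4 hMj
    have h6 : (j : ℚ) * (- M / j) = - M := mul_div_cancel₀ _ hjq.ne'
    linarith

end PercRepro.PuncturedLYM
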